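import Mathlib
import Summits.ValiantsHypothesis.ValiantsHypothesis.Theorems.FifoMatchingNNDivisionHardFewArcFaces
import HarnessLib

/-!
# Route FifoMatching — crux `NNDivisionHard` (stmt-ValiantsHypothesis-21181): POSITIVE POWER SUMS OF BOUNDEDLY MANY PERFECT
# MATCHINGS LED BY A NEST-FREE ONE ARE NOT CERTIFICATES — `h = (c₀·x^{M₀} + Σ_{M ∈ 𝓜} c_M·x^M)^D`, every degree `D`

The explicit family closed by the bounded-separating-set tier `…FewArcFaces.fewArcsGeneric_not_certificate_qp`: for a
nest-free perfect matching `M₀`, a set `𝓜` of at most `k` OTHER perfect matchings and nonnegative coefficients, ONE arc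
`e_M ∈ M ∖ M₀` per competitor gives a separating set `I = {e_M}` of size `≤ k` avoided by `M₀` and met by every `M ∈ 𝓜`; in
direction `𝟙_{I^c}` the outer face of `c₀ x^{M₀} + Σ c_M x^M` is `c₀ x^{M₀}` alone, hence that of its `D`-th power is a monomial.

* `exists_separating_arcs` — the separating set;
* ★★ `powerSum_not_certificate_qp` — **for every `k, c`, eventually in `n`: for every nest-free perfect matching `M₀`, every set
  `𝓜` of at most `k` perfect matchings not containing `M₀`, all coefficients `c_M ≥ 0`, `c₀ ≠ 0` and EVERY `D`,
  `h = (c₀·x^{M₀} + Σ_{M ∈ 𝓜} c_M·x^M)^D` satisfies `2^((log₂ n + c)^c) < L₊(NN_n · h) + L₊(h)`.**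

These cofactors are monotone-cheap for `D` up to `2^{2^{polylog}}` (repeated squaring), torus-homogeneous, spread, unsaturated and
of arbitrary degree — the natural «few-matchings» members of every earlier residual of record.  Sums over MANY matchings
(`|𝓜|` growing with `n`, e.g. `NN_n^D`, faces of `NN_n`) are NOT covered.  HONEST FRAMING: one explicit family for ONE candidate;
stmt-21181 stays OPEN; nothing here bears on `NNNotVP` or on VP ≠ VNP (NOT proved).  No definitions, no named facts.
References: Hrubeš–Yehudayoff 2021 §6 Problem 2 [HrubesYehudayoff2021].
-/

noncomputable section

-- Sub = Summit single-conjunct layout: the duplicated namespace component is mandated by the tree.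
set_option linter.dupNamespace false
set_option autoImplicit false

namespace Summit.ValiantsHypothesis.ValiantsHypothesis.Theorems.FifoMatching.NNDivisionHard.PowerSums

open Finset MvPolynomial Literature.Computability.AlgebraicComplexity
open Summit.ValiantsHypothesis.ValiantsHypothesis.Theorems.ZeroOneTransfer.Negative (topComponent topComponent_mul)
open Summit.ValiantsHypothesis.ValiantsHypothesis.Theorems.FifoMatching.NNDivisionHard.LocalCofactor
  (weight_le weight_eq_iff)
open Summit.ValiantsHypothesis.ValiantsHypothesis.Theorems.FifoMatching.NNDivisionHard.ArcElimination
  (topComponent_add_eq_left_of_lt)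
open Summit.ValiantsHypothesis.ValiantsHypothesis.Theorems.FifoMatching.NNDivisionHard.ArcFaces (exists_opener_ne_of_ne)
open Summit.ValiantsHypothesis.ValiantsHypothesis.Theorems.FifoMatching.NNDivisionHard.FewArcFaces
  (fewArcsGeneric_not_certificate_qp)
open scoped NNReal BigOperators

variable {n : ℕ}

/-- **The separating arc set.**  For a perfect matching `M₀` and a set `𝓜` of perfect matchings not containing `M₀` there is
an arc set `I` with `|I| ≤ |𝓜|`, avoided by `M₀` and met by every member of `𝓜`. [folklore] -/
theorem exists_separating_arcs {M₀ : Fin (2 * n) → Fin (2 * n)} (hM₀ : M₀ ∈ perfectMatchings (2 * n))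
    (𝓜 : Finset (Fin (2 * n) → Fin (2 * n))) (h𝓜 : 𝓜 ⊆ perfectMatchings (2 * n)) (hnot : M₀ ∉ 𝓜) :
    ∃ I : Finset (Fin (2 * n) × Fin (2 * n)), I.card ≤ 𝓜.card ∧ (∀ j ∈ openers M₀, (j, M₀ j) ∉ I) ∧
      ∀ M ∈ 𝓜, ∃ j ∈ openers M, (j, M j) ∈ I := by
  classical
  have hch : ∀ M ∈ 𝓜, ∃ i : Fin (2 * n), i < M i ∧ M₀ i ≠ M i := fun M hM =>
    exists_opener_ne_of_ne hM₀ (h𝓜 hM) (fun h => hnot (h ▸ hM))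
  by_cases h𝓜e : 𝓜 = ∅
  · subst h𝓜e
    exact ⟨∅, le_rfl, fun j _ h => Finset.notMem_empty _ h, fun M hM => absurd hM (Finset.notMem_empty _)⟩
  obtain ⟨M₁, hM₁⟩ := Finset.nonempty_iff_ne_empty.2 h𝓜e
  obtain ⟨i₁, -, -⟩ := hch M₁ hM₁
  haveI : Nonempty (Fin (2 * n)) := ⟨i₁⟩
  choose! f hf using hch
  refine ⟨𝓜.image (fun M => (f M, M (f M))), Finset.card_image_le, fun j hj hmem => ?_, fun M hM => ?_⟩
  · rw [Finset.mem_image] at hmem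
    obtain ⟨M, hM, hEq⟩ := hmem
    rw [Prod.mk.injEq] at hEq
    obtain ⟨h1, h2⟩ := hEq
    subst h1
    exact (hf M hM).2 h2.symm
  · exact ⟨f M, mem_openers.2 (hf M hM).1, Finset.mem_image.2 ⟨M, hM, rfl⟩⟩

/-- ★★ **POWER SUMS OF FEW MATCHINGS ARE NOT CERTIFICATES.**  For every `k, c`, eventually in `n`: `M₀` nest-free, `𝓜` a set of
at most `k` perfect matchings with `M₀ ∉ 𝓜`, `cf ≥ 0`, `c₀ ≠ 0`, any `D`:
`2^((log₂ n + c)^c) < L₊(NN_n · h) + L₊(h)` for `h = (c₀·x^{M₀} + Σ_{M ∈ 𝓜} cf M · x^M)^D`. [cite: HrubesYehudayoff2021, §6 Problem 2] -/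
theorem powerSum_not_certificate_qp (k c : ℕ) : ∃ n₀ : ℕ, ∀ n : ℕ, n₀ ≤ n →
    ∀ M₀ : Fin (2 * n) → Fin (2 * n), M₀ ∈ nestFreeMatchings (2 * n) →
    ∀ 𝓜 : Finset (Fin (2 * n) → Fin (2 * n)), 𝓜 ⊆ perfectMatchings (2 * n) → 𝓜.card ≤ k → M₀ ∉ 𝓜 →
    ∀ (cf : (Fin (2 * n) → Fin (2 * n)) → ℝ≥0) (c₀ : ℝ≥0), c₀ ≠ 0 → ∀ D : ℕ,
      2 ^ ((Nat.log 2 n + c) ^ c) <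
        complexity (nestFreeMatchingPoly n ℝ≥0 *
          (C c₀ * arcMonomial ℝ≥0 M₀ + ∑ M ∈ 𝓜, C (cf M) * arcMonomial ℝ≥0 M) ^ D) +
        complexity ((C c₀ * arcMonomial ℝ≥0 M₀ + ∑ M ∈ 𝓜, C (cf M) * arcMonomial ℝ≥0 M) ^ D) := by
  obtain ⟨n₀, hn₀⟩ := fewArcsGeneric_not_certificate_qp k c
  refine ⟨n₀, fun n hn M₀ hM₀ 𝓜 h𝓜 hk hnot cf c₀ hc₀ D => ?_⟩
  classical
  have hPM₀ := nestFreeMatchings_subset_perfectMatchings hM₀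
  obtain ⟨I, hIcard, hI₀, hImeet⟩ := exists_separating_arcs hPM₀ 𝓜 h𝓜 hnot
  set w : Fin (2 * n) × Fin (2 * n) → ℕ := fun v => if v ∈ I then 0 else 1 with hw
  -- the outer face of the base is `c₀ · x^{M₀}`
  have hwM₀ : Finsupp.weight w (arcExponent M₀) = n := (weight_eq_iff I hPM₀).2 hI₀
  have hmon : C c₀ * arcMonomial ℝ≥0 M₀ = monomial (arcExponent M₀) c₀ := by
    rw [arcMonomial_eq_monomial, C_mul_monomial, mul_one]
  have hq : ∀ d ∈ (∑ M ∈ 𝓜, C (cf M) * arcMonomial ℝ≥0 M).support, Finsupp.weight w d < n := by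
    intro d hd
    obtain ⟨M, hM, hdM⟩ := Finset.mem_biUnion.1 (support_sum hd)
    rw [arcMonomial_eq_monomial, C_mul_monomial, mul_one] at hdM
    have hd' := support_monomial_subset hdM
    rw [Finset.mem_singleton] at hd'
    subst hd'
    have hle := weight_le I (h𝓜 hM)
    have hne : Finsupp.weight w (arcExponent M) ≠ n := by
      intro heq
      obtain ⟨j, hj, hjI⟩ := hImeet M hM
      exact (weight_eq_iff I (h𝓜 hM)).1 heq j hj hjI
    exact lt_of_le_of_ne hle hne
  have htop1 : topComponent w (C c₀ * arcMonomial ℝ≥0 M₀ + ∑ M ∈ 𝓜, C (cf M) * arcMonomial ℝ≥0 M) =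
      monomial (arcExponent M₀) c₀ := by
    rw [hmon]
    refine topComponent_add_eq_left_of_lt w (W := n) ?_ (isWeightedHomogeneous_monomial w _ _ hwM₀) hq
    rw [Ne, monomial_eq_zero]; exact hc₀
  have htop : topComponent w ((C c₀ * arcMonomial ℝ≥0 M₀ + ∑ M ∈ 𝓜, C (cf M) * arcMonomial ℝ≥0 M) ^ D) =
      monomial (D • arcExponent M₀) (c₀ ^ D) := by
    have hpow : ∀ N : ℕ, topComponent w ((C c₀ * arcMonomial ℝ≥0 M₀ + ∑ M ∈ 𝓜, C (cf M) * arcMonomial ℝ≥0 M) ^ N) =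
        topComponent w (C c₀ * arcMonomial ℝ≥0 M₀ + ∑ M ∈ 𝓜, C (cf M) * arcMonomial ℝ≥0 M) ^ N := by
      intro N
      induction N with
      | zero => rw [pow_zero, pow_zero, ← C_1,
          Summit.ValiantsHypothesis.ValiantsHypothesis.Theorems.ZeroOneTransfer.Negative.topComponent_C]
      | succ N ih => rw [pow_succ, pow_succ, topComponent_mul, ih]
    rw [hpow D, htop1, monomial_pow]
  exact hn₀ n hn I (hIcard.trans hk) _ _ _ (pow_ne_zero D hc₀) htop

/-- ★★ **POWER SUMS OF FEW PERFECT MATCHINGS — no nest-free leader needed.**  For every `k, c`, eventually in `n`: for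
EVERY perfect matching `M₀` (nest-free or not), every set `𝓜` of at most `k` perfect matchings with `M₀ ∉ 𝓜`, `cf ≥ 0`,
`c₀ ≠ 0` and every `D`, `h = (c₀·x^{M₀} + Σ_{M ∈ 𝓜} cf M · x^M)^D` satisfies `2^((log₂ n + c)^c) < L₊(NN_n · h) + L₊(h)`
(the separating arc set is avoided by SOME nest-free perfect matching by `…FewArcsAvoidable`, which is all the tier needs; so
every positive power sum of at most `k + 1` distinct perfect matchings is decided). [cite: HrubesYehudayoff2021, §6 Problem 2] -/
theorem powerSum_not_certificate_qp' (k c : ℕ) : ∃ n₀ : ℕ, ∀ n : ℕ, n₀ ≤ n →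
    ∀ M₀ : Fin (2 * n) → Fin (2 * n), M₀ ∈ perfectMatchings (2 * n) →
    ∀ 𝓜 : Finset (Fin (2 * n) → Fin (2 * n)), 𝓜 ⊆ perfectMatchings (2 * n) → 𝓜.card ≤ k → M₀ ∉ 𝓜 →
    ∀ (cf : (Fin (2 * n) → Fin (2 * n)) → ℝ≥0) (c₀ : ℝ≥0), c₀ ≠ 0 → ∀ D : ℕ,
      2 ^ ((Nat.log 2 n + c) ^ c) <
        complexity (nestFreeMatchingPoly n ℝ≥0 *
          (C c₀ * arcMonomial ℝ≥0 M₀ + ∑ M ∈ 𝓜, C (cf M) * arcMonomial ℝ≥0 M) ^ D) +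
        complexity ((C c₀ * arcMonomial ℝ≥0 M₀ + ∑ M ∈ 𝓜, C (cf M) * arcMonomial ℝ≥0 M) ^ D) := by
  obtain ⟨n₀, hn₀⟩ := fewArcsGeneric_not_certificate_qp k c
  refine ⟨n₀, fun n hn M₀ hPM₀ 𝓜 h𝓜 hk hnot cf c₀ hc₀ D => ?_⟩
  classical
  obtain ⟨I, hIcard, hI₀, hImeet⟩ := exists_separating_arcs hPM₀ 𝓜 h𝓜 hnot
  set w : Fin (2 * n) × Fin (2 * n) → ℕ := fun v => if v ∈ I then 0 else 1 with hw
  have hwM₀ : Finsupp.weight w (arcExponent M₀) = n := (weight_eq_iff I hPM₀).2 hI₀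
  have hmon : C c₀ * arcMonomial ℝ≥0 M₀ = monomial (arcExponent M₀) c₀ := by
    rw [arcMonomial_eq_monomial, C_mul_monomial, mul_one]
  have hq : ∀ d ∈ (∑ M ∈ 𝓜, C (cf M) * arcMonomial ℝ≥0 M).support, Finsupp.weight w d < n := by
    intro d hd
    obtain ⟨M, hM, hdM⟩ := Finset.mem_biUnion.1 (support_sum hd)
    rw [arcMonomial_eq_monomial, C_mul_monomial, mul_one] at hdM
    have hd' := support_monomial_subset hdM
    rw [Finset.mem_singleton] at hd'
    subst hd'
    have hle := weight_le I (h𝓜 hM)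
    have hne : Finsupp.weight w (arcExponent M) ≠ n := by
      intro heq
      obtain ⟨j, hj, hjI⟩ := hImeet M hM
      exact (weight_eq_iff I (h𝓜 hM)).1 heq j hj hjI
    exact lt_of_le_of_ne hle hne
  have htop1 : topComponent w (C c₀ * arcMonomial ℝ≥0 M₀ + ∑ M ∈ 𝓜, C (cf M) * arcMonomial ℝ≥0 M) =
      monomial (arcExponent M₀) c₀ := by
    rw [hmon]
    refine topComponent_add_eq_left_of_lt w (W := n) ?_ (isWeightedHomogeneous_monomial w _ _ hwM₀) hq
    rw [Ne, monomial_eq_zero]; exact hc₀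
  have htop : topComponent w ((C c₀ * arcMonomial ℝ≥0 M₀ + ∑ M ∈ 𝓜, C (cf M) * arcMonomial ℝ≥0 M) ^ D) =
      monomial (D • arcExponent M₀) (c₀ ^ D) := by
    have hpow : ∀ N : ℕ, topComponent w ((C c₀ * arcMonomial ℝ≥0 M₀ + ∑ M ∈ 𝓜, C (cf M) * arcMonomial ℝ≥0 M) ^ N) =
        topComponent w (C c₀ * arcMonomial ℝ≥0 M₀ + ∑ M ∈ 𝓜, C (cf M) * arcMonomial ℝ≥0 M) ^ N := by
      intro N
      induction N with
      | zero => rw [pow_zero, pow_zero, ← C_1,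
          Summit.ValiantsHypothesis.ValiantsHypothesis.Theorems.ZeroOneTransfer.Negative.topComponent_C]
      | succ N ih => rw [pow_succ, pow_succ, topComponent_mul, ih]
    rw [hpow D, htop1, monomial_pow]
  exact hn₀ n hn I (hIcard.trans hk) _ _ _ (pow_ne_zero D hc₀) htop

end Summit.ValiantsHypothesis.ValiantsHypothesis.Theorems.FifoMatching.NNDivisionHard.PowerSums

end
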